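import Summits.QuantumFields.YangMills.Theorems.BalabanUVNodesN15TwoSpacingGluingCurvedKnitDefectObjects
import Summits.QuantumFields.YangMills.Theorems.BalabanUVNodesN15BackgroundV1Gauge
import Summits.QuantumFields.YangMills.Theorems.BalabanUVNodesN15BackgroundMatrixByPartsTwoSidedLettersNode
import Summits.QuantumFields.YangMills.Theorems.BalabanUVNodesN15VectorPieceBackground
import HarnessLib

/-!
# THE GLUING STEP AT TWO LATTICE SPACINGS — (Λ2c) THE NODE OBJECTS OF THE LIVE-BACKGROUND GLUED FAMILY IN THE GLOBAL SMALL-FIELD GAUGE: the skew-Hermitian C²-window carrier,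
# King's pairing, the realised paired instance (`M = L^m` LIVE) and the kernel family whose ENTRY 0 is the η-defect of the live glued propagators (dag-n15-c g16, FILE 131; N15 = NE2, s1)

Cell `pub-ymgap`, seat `pub-ymgap-dag-n15-c` (R134 (a); HUMAN RULING D-0062), generation 16.  `bears_on: R4∕N15 · K3⁸ SpineGivenEndpointR13SepCoPHV (stmt-QuantumFields-27366)`.
Filed `--kind definition --supports stmt-QuantumFields-27366 --as helper` — COUNT-NEUTRAL.  Definitions (reviewed lane) + unfolding lemmas; 0 `sorry`, 0 `instance`.  Imports BY NAME FILE 123a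
`…CurvedKnitDefectObjects` (`cvGlued`, `cvGlued′`, `cvNL`, `cvNL′`, `CvX`, `CvX′`, `cvBlk`, `cvM`), dag-n15-c g2 `…BackgroundV1Gauge` (`v1GaugeBg` = the C²-window gauge carrier),
dag-n15-c FILE 24 `…BackgroundMatrixByPartsTwoSidedLettersNode` (`bgInstanceM₂R` = the realised two-sided instance over ANY carrier pair), dag-n15-a `…VectorPieceBackground`
(`unitTorusGeoS` = the SIZED unit-torus carrier), n15-b `opGeo`∕`opFamily`∕`fineGeo`, g1 `gavgM`.  Nothing in the tree is modified.

WHAT (objects for FILE 132's `NE2PlusOperator` readout of FILES 129∕130):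
* `SfIdx` — the index of the family: cube scale `m` (doubled torus `2L·L^m`, [B9] size parameter `M = L^m`), coarse scales `k ≥ 1`, fine extra scales `r`;
* `sfGaugeBg mm J s η M` — THE SKEW-HERMITIAN C²-WINDOW CARRIER: configurations `A : J → X → M_m(ℂ)`; `Reg335 c α₀ A` = «`A` skew-Hermitian» ∧ `v1GaugeBg`'s three unit-scale letters
  at scale `cMα₀` (sup, all one-step differences `·η`, all mixed second differences `·η²`) — our reading of (3.35)–(3.36) in a GLOBAL gauge; `Reg336` repeats it; (3.37)–(3.38) inert;
* `sfPairing` — the η-pairing (NOT PRINTED data): identity on sites, pull-back of `𝔲(m) ≅ ℝ^ι`-valued test functions along King's bond pairing, backgrounds transported by the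
  fibrewise mean `gavgM` (`avg_one`: `gavgM 0 = 0`);
* `sfInstance` — the realised paired instance at index `i` (`bgInstanceM₂R` over the sized carrier `unitTorusGeoS L i.kk (cvM …) (L^{i.m})`: THE GUARD `M₅ ≤ M` IS LIVE, `sfInstance_gf_M`);
* `sfEntry0` — ENTRY 0: `𝔇_π̂(cvGlued′ … 1 e^{η′A′} (N′_L⊗1) 0, cvGlued … 1 e^{ηĀ′} (N_L⊗1) 0)`, `Ā′ = gavgM π̂ A′` (FILE 130's operator);
* `sfOps E` ∕ `sfFamily E` — the four entry operators ∕ the kernel family: entry 0 = `sfEntry0`, entries 1–3 = the consumer's operators `E 1, E 2, E 3` (the gradient entries of the live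
  glued operator are NOT in the tree — dag-n15-w3's 52∕53 conclude entry 0 only — so they stay the consumer's, displayed in FILE 132).

HONEST FRAMING ∕ LIMITS.  Plumbing only (structures + `rfl` lemmas); MODEL carriers ∕ class ∕ pairing ∕ operator as in FILES 129∕130; nothing of [B5]∕[B6]∕[B9] asserted; NE2⁺ NOT PRINTED, NOT
proved; N15 NOT discharged; K3⁸ OPEN, skeleton v6 untouched (0∕2); counts of record UNMOVED (typed 28∕28 · discharged 5∕27 · A 5∕28); one finite 𝕋⁴ at fixed ε — NOT infinite volume, NOT OS on
ℝ⁴, NOT a mass gap, NOT Clay; R4 closes the conditional finite-𝕋⁴ rung `BalabanLadder.UV` only.  Restate-immune (no Theses import).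
-/

noncomputable section

open scoped BigOperators Matrix Matrix.Norms.Frobenius

namespace Summit.QuantumFields.YangMills.BalabanUVNodes.N15.Gluing

open Literature.MathematicalPhysics.QuantumFieldTheory.Balaban1983to89
open Literature.MathematicalPhysics.QuantumFieldTheory.Balaban1983to89.T4EtaRate (PairedInstance EtaPairing)
open Literature.MathematicalPhysics.QuantumFieldTheory.Balaban1983to89.T4EtaRateDefect (idef)
open Literature.MathematicalPhysics.QuantumFieldTheory.Balaban1983to89.T4EtaRateCoeffDefect (pull)
open Literature.MathematicalPhysics.QuantumFieldTheory.Balaban1983to89.B11SectG (BlockNorm)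
open Summit.QuantumFields.YangMills.BalabanUVNodes.N15.BackgroundLayer (v1GaugeBg gavgM gavgM_zero fineGeo bgInstanceM₂R abs_le_iSup_abs)
open Summit.QuantumFields.YangMills.BalabanUVNodes.N15.VectorPiece (bshiftEquiv kingPrV unitTorusGeoS)
open Summit.QuantumFields.YangMills.BalabanUVNodes.N15.MatrixSpecies (liftMap liftBlk)
open Summit.QuantumFields.YangMills.BalabanUVNodes.N15.OperatorReadout (opGeo opFamily)

variable {d : ℕ}

/-! ## §1 The skew-Hermitian C²-window carrier and its pairing -/

section Carrier

variable (mm J : Type) [Fintype mm] [DecidableEq mm] {X X' : Type}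

/-- **THE SKEW-HERMITIAN C²-WINDOW GAUGE CARRIER**: configurations = `M_m(ℂ)`-valued gauge potentials `A : J → X → M_m(ℂ)` (`U = e^{ηA}`); `one := 0`, `mul := (+)`;
`Reg335 c α₀ A` = «every `A_μ(x)` is skew-Hermitian» ∧ g2's `v1GaugeBg` letters (`‖A_μ(x)‖ ≤ cMα₀`, `‖A_μ(x + e_κ) − A_μ(x)‖ ≤ cMα₀·η`,
`‖(A_μ(x + e_κ) − A_μ(x)) − (A_μ(x − e_μ + e_κ) − A_μ(x − e_μ))‖ ≤ cMα₀·η²`, Frobenius norm); `Reg336` repeats it; (3.37)–(3.38) inert.  Our GLOBAL-gauge reading of (3.35)–(3.36) (the print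
allows a gauge per cube and bounds `∂*∂A` only). [cite: Balaban1985BackgroundPropagators, (3.35)–(3.36) p.396 (shape)] -/
def sfGaugeBg (s : J → X ≃ X) (η M : ℝ) : B9.Backgrounds where
  Cfg := J → X → Matrix mm mm ℂ
  one := 0
  mul := fun A₁ A₂ => A₁ + A₂
  Reg335 := fun c α₀ A => (∀ μ x, (A μ x)ᴴ = -A μ x) ∧ (v1GaugeBg (Matrix mm mm ℂ) J s η M).Reg335 c α₀ A
  Reg336 := fun c α₀ A => (∀ μ x, (A μ x)ᴴ = -A μ x) ∧ (v1GaugeBg (Matrix mm mm ℂ) J s η M).Reg335 c α₀ A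
  Cplx337 := fun _ _ _ => True
  Cplx338 := fun _ _ _ => True

/-- Unfolding of the carrier's (3.35). [folklore] -/
theorem reg335_sfGaugeBg_iff (s : J → X ≃ X) (η M c α₀ : ℝ) (A : J → X → Matrix mm mm ℂ) :
    (sfGaugeBg mm J s η M).Reg335 c α₀ A ↔
      (∀ μ x, (A μ x)ᴴ = -A μ x) ∧ (∀ μ x, ‖A μ x‖ ≤ c * M * α₀) ∧ (∀ μ κ x, ‖A μ (s κ x) - A μ x‖ ≤ c * M * α₀ * η) ∧
        ∀ μ κ x, ‖(A μ (s κ x) - A μ x) - (A μ (s κ ((s μ).symm x)) - A μ ((s μ).symm x))‖ ≤ c * M * α₀ * η * η := Iff.rfl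

variable [Fintype X'] [DecidableEq X] {g : B6.Geometry} [Fintype X] (ι : Type) [Fintype ι]

/-- THE η-PAIRING over the skew-Hermitian carriers on the product carrier `X × ι` (NOT PRINTED data): coarse spacing `η`, fine spacing `η′ = η·L^{−n}`, identity on sites, test functions pulled
back along `π`, backgrounds transported by the fibrewise mean `gavgM` (g2 `v1GaugePairing`'s fields verbatim). [cite: King1986, p.664 (convention before Prop. 3.8)] -/
def sfPairing (blk : X → g.Site) (π : X' → X) (s : J → X ≃ X) (s' : J → X' ≃ X') (n : ℕ) (hL : g.L ≠ 0) :
    EtaPairing (opGeo g (X × ι) (liftBlk blk ι)) (fineGeo g (X' × ι) (liftBlk (blk ∘ π) ι) n) (sfGaugeBg mm J s g.eta g.M)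
      (sfGaugeBg mm J s' (g.eta * (g.L ^ n)⁻¹) g.M) where
  n := n
  k_eq := rfl
  L_eq := rfl
  M_eq := rfl
  eta_eq := by
    show g.eta * (g.L ^ n)⁻¹ * g.L ^ n = g.eta
    rw [mul_assoc, inv_mul_cancel₀ (pow_ne_zero _ hL), mul_one]
  ι := fun y => y
  scale_ι := fun _ => rfl
  dist_ι := fun _ _ => rfl
  τ := fun lam => pull (liftMap π ι) lam
  suppIn_τ := fun _ _ h p hp => h (liftMap π ι p) hp
  supNorm_τ := fun lam => by
    show (⨆ p : X' × ι, |lam (liftMap π ι p)|) ≤ ⨆ p : X × ι, |lam p|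
    exact Real.iSup_le (fun p => abs_le_iSup_abs lam (liftMap π ι p)) (Real.iSup_nonneg fun p => abs_nonneg _)
  avg := gavgM (Matrix mm mm ℂ) J π
  avg_one := gavgM_zero (Matrix mm mm ℂ) J π

end Carrier

/-! ## §2 The index, the realised instance (`M = L^m` live), entry 0 and the kernel family -/

section Family

/-- THE INDEX of the live glued family at the cover: cube scale `m` (doubled torus `2L·L^m`, cubes of side `L·L^m`, [B9] size parameter `M = L^m`), the coarse run's `k ≥ 1` scales, the
fine run's extra `r` scales. [cite: Balaban1985BackgroundPropagators, Thm 3.1 p.397 («for M ≥ M₁»: the size parameter)] -/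
structure SfIdx (d L : ℕ) : Type where
  /-- cube scale: size parameter `M = L^m` -/
  m : ℕ
  /-- number of scales of the coarse run -/
  kk : ℕ
  /-- extra scales of the fine run -/
  r : ℕ
  /-- `k ≥ 1` -/
  one_le : 1 ≤ kk

variable (d) {L : ℕ} [NeZero L] (mm ι : Type) [Fintype mm] [DecidableEq mm] [Fintype ι] [DecidableEq ι]

/-- THE SIZED CARRIER of the index: the unit-torus carrier of the doubled torus `2L·L^m` at `k` scales with [B9] size parameter `M = L^m`. [cite: Balaban1985BackgroundPropagators, Thm 3.1 p.397 (the size parameter)] -/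
abbrev sfGeo (hL : Odd L ∧ 1 < L) (i : SfIdx d L) : B6.Geometry := unitTorusGeoS L i.kk (cvM d L i.m i.kk hL) ((L : ℝ) ^ i.m)

/-- `L ≠ 0` on the carrier. [folklore] -/
theorem sfGeo_L_ne_zero (hL : Odd L ∧ 1 < L) (i : SfIdx d L) : (sfGeo d hL i).L ≠ 0 := Nat.cast_ne_zero.mpr (NeZero.ne L)

/-- THE REALISED PAIRED INSTANCE of the index over the skew-Hermitian C²-window carriers (coarse spacing `η = L^{−k}`, fine `η′ = η·L^{−r}`, bond shifts `bshiftEquiv`, King's bond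
pairing), FILE 24's `bgInstanceM₂R` over the SIZED carrier. [cite: Balaban1985BackgroundPropagators, Thm 3.14 pp.426–427 (typing template); (3.35)–(3.36) p.396 (shapes)] -/
def sfInstance (hL : Odd L ∧ 1 < L) (i : SfIdx d L) : PairedInstance :=
  bgInstanceM₂R (ι := ι) (g := sfGeo d hL i) (cvBlk d L i.m i.kk hL) (kingPrV L i.kk i.r (cvM d L i.m i.kk hL)) i.r
    (sfGaugeBg mm (Fin (d + 1)) (fun μ => bshiftEquiv (cvM d L i.m i.kk hL) (L ^ i.kk) μ) (sfGeo d hL i).eta (sfGeo d hL i).M)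
    (sfGaugeBg mm (Fin (d + 1)) (fun μ => bshiftEquiv (cvM d L i.m i.kk hL) (L ^ i.r * L ^ i.kk) μ) ((sfGeo d hL i).eta * ((sfGeo d hL i).L ^ i.r)⁻¹) (sfGeo d hL i).M)
    (sfPairing mm (Fin (d + 1)) ι (g := sfGeo d hL i) (cvBlk d L i.m i.kk hL) (kingPrV L i.kk i.r (cvM d L i.m i.kk hL)) (fun μ => bshiftEquiv (cvM d L i.m i.kk hL) (L ^ i.kk) μ)
      (fun μ => bshiftEquiv (cvM d L i.m i.kk hL) (L ^ i.r * L ^ i.kk) μ) i.r (sfGeo_L_ne_zero d hL i))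

omit [DecidableEq mm] [DecidableEq ι] in
/-- THE GUARD IS LIVE: the fine geometry's [B9] size parameter is `L^m`. [folklore] -/
theorem sfInstance_gf_M (hL : Odd L ∧ 1 < L) (i : SfIdx d L) : (sfInstance d mm ι hL i).gf.M = (L : ℝ) ^ i.m := rfl

omit [DecidableEq mm] [DecidableEq ι] in
/-- `L^m` is unbounded on the family: no bounded-`M` witness (given one `k ≥ 1`). [folklore] -/
theorem sfInstance_gf_M_unbounded (hL : Odd L ∧ 1 < L) {kk : ℕ} (hk : 1 ≤ kk) (M₅ : ℝ) : ∃ i : SfIdx d L, M₅ ≤ (sfInstance d mm ι hL i).gf.M := by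
  obtain ⟨m, hm⟩ := pow_unbounded_of_one_lt M₅ (by exact_mod_cast hL.2 : (1 : ℝ) < (L : ℝ))
  exact ⟨⟨m, kk, 0, hk⟩, hm.le⟩

omit [DecidableEq ι] in
/-- The fine carrier's (3.35) unfolds to: skew-Hermitian ∧ the three C²-window letters at scale `c·L^m·α₀` with the fine spacing `η′ = L^{−k}·(L^r)^{−1}`. [folklore] -/
theorem sfInstance_reg335_iff (hL : Odd L ∧ 1 < L) (i : SfIdx d L) (c α₀ : ℝ) (A' : Fin (d + 1) → CvX' d L i.m i.kk i.r hL → Matrix mm mm ℂ) :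
    (sfInstance d mm ι hL i).Bf.Reg335 c α₀ A' ↔
      (∀ μ x', (A' μ x')ᴴ = -A' μ x') ∧ (∀ μ x', ‖A' μ x'‖ ≤ c * (L : ℝ) ^ i.m * α₀) ∧
        (∀ μ κ x', ‖A' μ (bshiftEquiv (cvM d L i.m i.kk hL) (L ^ i.r * L ^ i.kk) κ x') - A' μ x'‖ ≤ c * (L : ℝ) ^ i.m * α₀ * (((L : ℝ) ^ i.kk)⁻¹ * ((L : ℝ) ^ i.r)⁻¹)) ∧
        ∀ μ κ x', ‖(A' μ (bshiftEquiv (cvM d L i.m i.kk hL) (L ^ i.r * L ^ i.kk) κ x') - A' μ x') -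
            (A' μ (bshiftEquiv (cvM d L i.m i.kk hL) (L ^ i.r * L ^ i.kk) κ ((bshiftEquiv (cvM d L i.m i.kk hL) (L ^ i.r * L ^ i.kk) μ).symm x')) -
              A' μ ((bshiftEquiv (cvM d L i.m i.kk hL) (L ^ i.r * L ^ i.kk) μ).symm x'))‖ ≤
          c * (L : ℝ) ^ i.m * α₀ * (((L : ℝ) ^ i.kk)⁻¹ * ((L : ℝ) ^ i.r)⁻¹) * (((L : ℝ) ^ i.kk)⁻¹ * ((L : ℝ) ^ i.r)⁻¹) := Iff.rfl

variable (a : ℝ) (e : Matrix mm mm ℂ ≃L[ℝ] (ι → ℝ))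

/-- **ENTRY 0 OF THE LIVE FAMILY**: the η-defect along King's bond pairing between the FINE glued operator (transporters `Ad_{e^{η′A′}}`, gauges `1`, summand `N′_L ⊗ 1`, perturbation `0`)
and the COARSE one for the block mean `Ā′ = gavgM π̂ A′` — FILE 130's operator. [cite: Balaban1985BackgroundPropagators, (3.42) p.397 (first entry: shape), Thm 3.14 pp.426–427 (difference template)] -/
def sfEntry0 (hL : Odd L ∧ 1 < L) (i : SfIdx d L) (A' : Fin (d + 1) → CvX' d L i.m i.kk i.r hL → Matrix mm mm ℂ) :
    (CvX d L i.m i.kk hL × ι → ℝ) →ₗ[ℝ] (CvX' d L i.m i.kk i.r hL × ι → ℝ) :=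
  idef (pull (liftMap (kingPrV L i.kk i.r (cvM d L i.m i.kk hL)) ι)) (pull (liftMap (kingPrV L i.kk i.r (cvM d L i.m i.kk hL)) ι))
    (cvGlued' d L i.m i.kk i.r hL a ((((L ^ i.r * L ^ i.kk : ℕ) : ℝ))⁻¹) ι e (fun _ _ => (1 : Matrix mm mm ℂ))
      (fun μ x' => NormedSpace.exp (((((L ^ i.r * L ^ i.kk : ℕ) : ℝ))⁻¹) • A' μ x')) (cvNL' d L i.m i.kk i.r hL a ι) (fun _ => 0))
    (cvGlued d L i.m i.kk hL a ((((L ^ i.kk : ℕ) : ℝ))⁻¹) ι e (fun _ _ => (1 : Matrix mm mm ℂ))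
      (fun μ x => NormedSpace.exp (((((L ^ i.kk : ℕ) : ℝ))⁻¹) • gavgM (Matrix mm mm ℂ) (Fin (d + 1)) (kingPrV L i.kk i.r (cvM d L i.m i.kk hL)) A' μ x)) (cvNL d L i.m i.kk hL a ι) (fun _ => 0))

/-- THE FOUR ENTRY OPERATORS: entry 0 = `sfEntry0`; entries 1–3 = the consumer's `E 1, E 2, E 3` (the live glued operator's GRADIENT entries are not in the tree).
[cite: Balaban1985BackgroundPropagators, (3.42) p.397 (the four entries: shape)] -/
def sfOps (hL : Odd L ∧ 1 < L) (i : SfIdx d L)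
    (E : Fin 4 → (Fin (d + 1) → CvX' d L i.m i.kk i.r hL → Matrix mm mm ℂ) → ((CvX d L i.m i.kk hL × ι → ℝ) →ₗ[ℝ] (CvX' d L i.m i.kk i.r hL × ι → ℝ))) :
    Fin 4 → (Fin (d + 1) → CvX' d L i.m i.kk i.r hL → Matrix mm mm ℂ) → ((CvX d L i.m i.kk hL × ι → ℝ) →ₗ[ℝ] (CvX' d L i.m i.kk i.r hL × ι → ℝ)) :=
  fun n A' => ![sfEntry0 d mm ι a e hL i A', E 1 A', E 2 A', E 3 A'] n

/-- Unfolding: entry 0. [folklore] -/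
@[simp] theorem sfOps_zero (hL : Odd L ∧ 1 < L) (i : SfIdx d L)
    (E : Fin 4 → (Fin (d + 1) → CvX' d L i.m i.kk i.r hL → Matrix mm mm ℂ) → ((CvX d L i.m i.kk hL × ι → ℝ) →ₗ[ℝ] (CvX' d L i.m i.kk i.r hL × ι → ℝ)))
    (A' : Fin (d + 1) → CvX' d L i.m i.kk i.r hL → Matrix mm mm ℂ) : sfOps d mm ι a e hL i E 0 A' = sfEntry0 d mm ι a e hL i A' := rfl

/-- Unfolding: entries 1–3 are the consumer's. [folklore] -/
theorem sfOps_succ (hL : Odd L ∧ 1 < L) (i : SfIdx d L)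
    (E : Fin 4 → (Fin (d + 1) → CvX' d L i.m i.kk i.r hL → Matrix mm mm ℂ) → ((CvX d L i.m i.kk hL × ι → ℝ) →ₗ[ℝ] (CvX' d L i.m i.kk i.r hL × ι → ℝ)))
    (A' : Fin (d + 1) → CvX' d L i.m i.kk i.r hL → Matrix mm mm ℂ) :
    sfOps d mm ι a e hL i E 1 A' = E 1 A' ∧ sfOps d mm ι a e hL i E 2 A' = E 2 A' ∧ sfOps d mm ι a e hL i E 3 A' = E 3 A' := ⟨rfl, rfl, rfl⟩

/-- Unfolding: every entry other than entry 0 is the consumer's. [folklore] -/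
theorem sfOps_of_ne_zero (hL : Odd L ∧ 1 < L) (i : SfIdx d L)
    (E : Fin 4 → (Fin (d + 1) → CvX' d L i.m i.kk i.r hL → Matrix mm mm ℂ) → ((CvX d L i.m i.kk hL × ι → ℝ) →ₗ[ℝ] (CvX' d L i.m i.kk i.r hL × ι → ℝ)))
    {n : Fin 4} (hn : n ≠ 0) (A' : Fin (d + 1) → CvX' d L i.m i.kk i.r hL → Matrix mm mm ℂ) : sfOps d mm ι a e hL i E n A' = E n A' := by
  fin_cases n
  · exact absurd rfl hn
  all_goals rfl

/-- THE KERNEL FAMILY of the index (n15-b `opFamily` on the product carriers: coarse blocks `liftBlk cvBlk ι`, fine blocks through King's pairing).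
[cite: Balaban1985BackgroundPropagators, (3.42) p.397 (shape)] -/
def sfFamily (hL : Odd L ∧ 1 < L) (i : SfIdx d L)
    (E : Fin 4 → (Fin (d + 1) → CvX' d L i.m i.kk i.r hL → Matrix mm mm ℂ) → ((CvX d L i.m i.kk hL × ι → ℝ) →ₗ[ℝ] (CvX' d L i.m i.kk i.r hL × ι → ℝ))) :
    B9.KernelFamily (sfInstance d mm ι hL i).gc (sfInstance d mm ι hL i).Bf :=
  show B9.KernelFamily (opGeo (sfGeo d hL i) (CvX d L i.m i.kk hL × ι) (liftBlk (cvBlk d L i.m i.kk hL) ι))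
      (sfGaugeBg mm (Fin (d + 1)) (fun μ => bshiftEquiv (cvM d L i.m i.kk hL) (L ^ i.r * L ^ i.kk) μ) ((sfGeo d hL i).eta * ((sfGeo d hL i).L ^ i.r)⁻¹) (sfGeo d hL i).M) from
    opFamily (g := sfGeo d hL i) (liftBlk (cvBlk d L i.m i.kk hL) ι) (liftBlk (cvBlk d L i.m i.kk hL ∘ kingPrV L i.kk i.r (cvM d L i.m i.kk hL)) ι) (sfOps d mm ι a e hL i E)

/-- Unfolding of the entries: the sharp fine-cube sup of the entry operator applied to the test function. [folklore] -/
theorem sfFamily_e (hL : Odd L ∧ 1 < L) (i : SfIdx d L)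
    (E : Fin 4 → (Fin (d + 1) → CvX' d L i.m i.kk i.r hL → Matrix mm mm ℂ) → ((CvX d L i.m i.kk hL × ι → ℝ) →ₗ[ℝ] (CvX' d L i.m i.kk i.r hL × ι → ℝ)))
    (n : Fin 4) (A' : Fin (d + 1) → CvX' d L i.m i.kk i.r hL → Matrix mm mm ℂ) (lam : CvX d L i.m i.kk hL × ι → ℝ) (y : (sfGeo d hL i).Site) :
    (sfFamily d mm ι a e hL i E).e n A' lam y =
      (BlockNorm.ofBlocks (sfGeo d hL i) (liftBlk (cvBlk d L i.m i.kk hL ∘ kingPrV L i.kk i.r (cvM d L i.m i.kk hL)) ι)).loc y (sfOps d mm ι a e hL i E n A' lam) := rfl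

end Family

end Summit.QuantumFields.YangMills.BalabanUVNodes.N15.Gluing

end
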